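import Literature.Geometry.Kaehler.ComplexTorusNeronSeveriLieAlgebra
import Literature.Geometry.Kaehler.ComplexTorusRosatiAntiInvariants
import Literature.Geometry.Kaehler.ComplexTorusNeronSeveriLieBracket
import HarnessLib

/-!
# Looijenga–Lunts 1997, §3 Proposition (3.6): the `ℚ`-structure of the three summands of the Néron–Severi Lie algebra
# `𝔤_NS(X; ℝ) = 𝔤₋₂ ⊕ 𝔤₀ ⊕ 𝔤₂` of an abelian variety, and its dimension
# `dim_ℝ 𝔤_NS(X; ℝ) = 2ρ(X) + dim_ℚ 𝔤_NS(X; ℚ)₀ = 2ρ(X) + dim_ℚ End⁰(X) - dim_ℚ 𝔲(X)`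

Layer `Literature/Geometry/Kaehler`, namespace `Literature.Geometry.Kaehler.ComplexTorus`; lane `lit-hodgefound` (Track 2
foundations library, Layer A: Hodge theory of complex tori on invariant forms), skeleton seat `lit-hodgefound-skel-1`
(generation 28), row **A1-56** of `run/shared/lean/pub/lit-hodgefound/SKELETON.md`.  A JUNCTION of three landed rows of
this seat, consumed BY NAME and not restated:

* A1-54 / A1-55 `ComplexTorusNeronSeveriLieAlgebra` (Looijenga–Lunts (1.1), (3.6)): the abstract model
  `model κ P₀ 𝒜 = ψ₋₂(𝒜^+κ⁻¹) ⊔ ψ₀(S^*) ⊔ ψ₂(κ𝒜^+) ⊆ 𝔰𝔬(V ⊕ V^*)` of a `†`-stable real subalgebra `𝒜 ⊆ End(V)` (`𝒜^+ =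
  symmPart κ P₀ 𝒜` the `†`-symmetric elements, `S = symmProdSpan κ P₀ 𝒜 = span(𝒜^+·𝒜^+)` "the Lie ideal of `𝒜` generated by
  `𝒜^+`", `𝔞(𝒜) = formsOf P₀ 𝒜 ≅ 𝒜^+` by `formsOfEquivSymmPart` = (3.5)), the structure theorem `llAlgebra_formsOf_eq :
  𝔤(𝔞(𝒜), H•(X)) = ρ(model) = llModel`, `degTwoEquiv : 𝔞(𝒜) ≅ 𝔤₂`, `degZeroHom : S ≅ 𝔤₀`, `eq_of_spinorRepLin_eq`
  (`ρ` injective on `𝔰𝔬`), `model_le_so`; and on the torus `X = V/Φ(ℤ^ι)`: `ρ = rhoR Φ : M_ι(ℚ) → End_ℝ(V)`,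
  `End(X) ⊗ ℝ = endAlgReal Φ = span_ℝ ρ(End_ℚ(X))`, `NS(X) ⊗ ℝ = neronSeveriR Φ = span_ℝ NS_ℚ(X)`,
  `symmPart_endAlgReal_eq`, `formsOf_endAlgReal_eq : 𝔞(End(X) ⊗ ℝ) = NS(X) ⊗ ℝ`, `neronSeveriDegTwoEquiv`,
  **`neronSeveriLieAlgebra_eq_llModel : 𝔤_NS(X; ℝ) = ρ(model)`** for `κ = η₀` a polarization, `𝒜 = End(X) ⊗ ℝ`;
* A1-53 `ComplexTorusRosatiAntiInvariants` (the `End⁰(X)`-side of (3.6), over `ℚ`, on the type `End⁰(X) = ↥(endAlgRat Φ)`):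
  `End⁰(X)^+ = rosatiSymm Φ G₀` (`map_val_rosatiSymm : = symmEndRat Φ G₀` of row A2-31), **`I = rosatiSymmIdeal Φ G₀`** "the
  Lie ideal of `End⁰(X)` that is generated by `End⁰(X)^+`" with `rosatiSymmIdeal_eq_span_mul : I = span_ℚ(End⁰(X)^+·End⁰(X)^+)`,
  `𝔲(X) = rosatiAntiInvariants Φ`, and the last clause of (3.6) `End⁰(X) = I ⊕ 𝔲(X)`
  (`finrank_rosatiSymmIdeal_add_finrank_rosatiAntiInvariants`, `rosatiSymmIdeal_eq_rosatiSymm_of_forall_mul_comm`,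
  `rosatiSymm_le_rosatiSymmIdeal`);
* A1-50 `ComplexTorusNeronSeveriLieBracket` ((3.5) through the total Lie algebra): `κ♭⁻¹ = sharp hnd`, `σ_λ = sigma hnd λ`,
  `rosatiInvariants κ`, `twoFormEquivRosatiInvariants`, `flat_comp_sharp`;
* rows A2-31 / A4 (`ComplexTorusNeronSeveriEndomorphisms`, `ComplexTorusPicardNumber`): `NS_ℚ(X) = neronSeveriQ Φ`, the
  rational Gram matrix `ratGram` (`map_ratGram`, `ratGram_add/_smul`, `eq_of_ratGram_eq`, `eq_of_latticeGram_eq`),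
  `neronSeveriQEquivHodgeClasses`, `finrank_neronSeveriGroup_eq_finrank_hodgeClasses` (`ρ(X) = rk NS(X) = neronSeveriGroup Φ`);
  `ComplexTorusAnalyticCharpoly`: `analyticRepReal Φ Φ M = Φ ∘ M ∘ Φ⁻¹` (`_apply`, `_add`, `_smul`);
* Mathlib: `linearIndependent_algebraMap_comp_iff` (base change of linear independence along `ℚ → ℝ`),
  `finrank_span_eq_card`, `Submodule.finrank_sup_add_finrank_inf_eq`, `Submodule.equivMapOfInjective`,
  `LinearMap.finrank_range_of_inj`, `Submodule.mul_eq_span_mul_set` / `Submodule.span_mul_span`.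

THEOREMS ONLY: no definition, no named fact, no `sorry` (net debt `0`).

## Source, VERBATIM

E. Looijenga, V. A. Lunts, *A Lie algebra attached to a projective variety*, Invent. Math. **129** (1997) 361–412 (held
text `paper:arxiv-alg-geom_9604014`; page/line numbers of that text):

> (§2, p0009 L110–L115) "Say that a Lefschetz pair `(𝔤, h)` is a Jordan–Lefschetz pair if `(𝔤, h, 𝔤_2)` is a Lefschetz
> triple. […] If `(𝔤, h)` is a Jordan–Lefschetz pair, then `𝔤 = 𝔤_{-2} ⊕ 𝔤_0 ⊕ 𝔤_2`".
>
> (§3, p0014 L22–L26) "We adhere to the convention to denote the `ℚ`-algebra `End(X) ⊗ ℚ` by `End⁰(X)` and we write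
> `V_ℚ` for `H₁(X; ℚ)` and `V` for `H₁(X; ℝ)`. We think of `End⁰(X)` as a subalgebra of `End(V_ℚ)`".
>
> (p0014 L70–L76) "**(3.6) Proposition.** The Néron–Severi Lie algebra of the abelian variety `X` is of Jordan type. **Its
> degree `2` summand is canonically isomorphic to `NS(X) ⊗ ℚ`. Its degree `0` summand can be identified with the Lie
> ideal of `End⁰(X)` that is generated by `End⁰(X)^+`** and this isomorphism makes `h` correspond to a scalar operator in
> `End⁰(X)`. **Moreover, `End⁰(X) = 𝔤_NS(X; ℚ)_0 × 𝔲(X)`.**"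
> (proof, L78–L85) "We only prove the last two assertions, as the others just sum up the preceding discussion. For a Jordan
> pair `(𝔤, h)`, `[𝔤_2, 𝔤_{-2}]` generates `𝔤_0` and so 3.5 implies that `𝔤_NS(X)_0` is the Lie algebra generated by
> the elements invariant under some Rosati involution. […] a standard argument shows that `𝔤_NS(X, ℝ)_0` must be the Lie
> ideal in `End(X) ⊗ ℝ` generated by `(End(X) ⊗ ℝ)^+`."
>
> ((3.8), p0016 L32–L34, the commutative case `F = K₀`, `m = 1` of the table) "Totally real multiplication. Then
> `𝔤_NS(A^m; ℚ)` is a `K_0`-form of `𝔰𝔭(2m)` and we have `𝔤_NS(A^m; ℚ)_0 = End(A^m) ⊗ ℚ ≅ End(m, K_0)`."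

Inputs, also printed: H. Lange, *Abelian Varieties over the Complex Numbers* (2023), §1.1.2 Prop. 1.1.9 (the rational and
analytic representations, `ρ_r ⊗ 1` faithful), §1.5.1 (the matrix of `E = Im H` on a lattice basis), §2.4.2 Prop. 2.4.12
(`NS_ℚ(X) ≅ End^s_ℚ(X)`); A. Beauville, *Some surfaces with maximal Picard number* (2014), §3 Prop. 3, proof
("`rk_ℤ End(A) = dim_ℝ End(A) ⊗_ℤ ℝ`": a `ℤ`/`ℚ`-basis of endomorphisms stays an `ℝ`-basis of the real span); S. Lang,
*Algebra* (2002), III §5 (dimension), XVI §4 (extension of the base).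

## What (3.6) says about dimensions, and what is formalised

By (3.6), `𝔤_NS(X; ℚ) = 𝔤₋₂ ⊕ 𝔤₀ ⊕ 𝔤₂` with `𝔤_{±2} ≅ NS(X) ⊗ ℚ` (of dimension `ρ(X) = rk NS(X)`) and `𝔤₀ ≅ 𝔤_NS(X; ℚ)₀ =`
the Lie ideal `I` of `End⁰(X)` generated by `End⁰(X)^+`, where `End⁰(X) = I × 𝔲(X)`; hence
`dim 𝔤_NS(X) = 2ρ(X) + dim_ℚ I = 2ρ(X) + dim_ℚ End⁰(X) - dim_ℚ 𝔲(X)`.  Rows A1-54/A1-55 formalise (3.6) OVER `ℝ` (on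
`𝔤_NS(X; ℝ) ⊆ 𝔤𝔩_ℂ(H•(X; ℂ))`, with `End(X) ⊗ ℝ`, `NS(X) ⊗ ℝ`, `S` realised as REAL SPANS inside `End_ℝ(V)`, `⋀²V^*`), row A1-53
formalises the `End⁰(X)`-side OVER `ℚ`.  This file supplies the missing junction — the `ℚ`-STRUCTURE of the real objects — and
the dimension count:

* §1 (the abstract model of A1-54 §§1–4, any `(κ, P₀, 𝒜)` with `κ♭ ∘ P₀ = 1` and `𝒜† ⊆ 𝒜`): `S = 𝒜^+·𝒜^+` as a `Submodule`
  product (`symmProdSpan_eq_mul`); the three block maps are injective and the three blocks are INDEPENDENT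
  (`disjoint_lowPiece_midPiece`, `disjoint_lowPiece_sup_midPiece_upPiece`: the model is a direct sum — LL §2 "`𝔤 = 𝔤_{-2} ⊕
  𝔤_0 ⊕ 𝔤_2`", here read off the block form), so **`finrank_model : dim model = 2·dim 𝒜^+ + dim S`**, `finrank_llModel`,
  **`finrank_llAlgebra_formsOf : dim 𝔤(𝔞(𝒜), H•(X)) = 2·dim 𝔞(𝒜) + dim S`**, and summand by summand `finrank_map_upPiece`
  (`dim 𝔤₂ = dim 𝔞(𝒜)`), `finrank_map_lowPiece` (`dim 𝔤₋₂ = dim 𝔞(𝒜)`), `finrank_map_midPiece` (`dim 𝔤₀ = dim S`).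
* §2 (base change `ℚ ⊂ ℝ`): `linearIndependent_matrix_map_ratCast` (`ℚ`-independent rational matrices are `ℝ`-independent,
  Mathlib's `linearIndependent_algebraMap_comp_iff` after flattening) and the generic count
  **`finrank_span_range_map_ratCast`**: for an injective `ℚ`-linear `g : N → M_ι(ℚ)` and an injective `ℝ`-linear
  `T : M_ι(ℝ) → W`, `dim_ℝ span_ℝ T(g(N) ⊗ ℝ) = dim_ℚ N`.
* §3 (the torus `X = V/Φ(ℤ^ι)`, no polarization needed): `ρ` is injective and `ℚ`-linear (`rhoR_injective`,
  `rhoR_ratCast_smul`, through the injective `ℝ`-linear `M ↦ Φ ∘ M ∘ Φ⁻¹`, `exists_linearMap_analyticRepReal`);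
  **`finrank_span_rhoR_image : dim_ℝ span_ℝ ρ(N) = dim_ℚ N`** for every `ℚ`-subspace `N ⊆ M_ι(ℚ)` (and `_coe` for `N` on the
  type `End⁰(X)`); **`finrank_endAlgReal : dim_ℝ End(X) ⊗ ℝ = dim_ℚ End⁰(X)`**; **`finrank_neronSeveriR : dim_ℝ NS(X) ⊗ ℝ =
  dim_ℚ NS_ℚ(X)`** (through the rational Gram matrices on the lattice basis) **`= ρ(X) = rk NS(X)`**
  (`finrank_neronSeveriR_eq_finrank_neronSeveriGroup`).  In particular A1-54's real spans ARE models of the tensor products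
  `End⁰(X) ⊗_ℚ ℝ`, `NS_ℚ(X) ⊗_ℚ ℝ` (A1-54 SCOPE (d) had left this unproved).
* §4 (the abelian variety: a polarization `η₀` with rational Gram matrix `G₀`, `P₀ = η₀♭⁻¹`):
  **`symmPart_endAlgReal_eq_span_rosatiSymm : (End(X) ⊗ ℝ)^+ = span_ℝ ρ(End⁰(X)^+)`** (`End⁰(X)^+ = rosatiSymm Φ G₀` of A1-53),
  `finrank_symmPart_endAlgReal : dim_ℝ (End(X) ⊗ ℝ)^+ = ρ(X)`, `finrank_rosatiSymm_eq_finrank_neronSeveriGroup : dim_ℚ End⁰(X)^+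
  = ρ(X)` ((3.5) as a count); **`symmProdSpan_endAlgReal_eq_span_rosatiSymmIdeal : S = span_ℝ ρ(I) = 𝔤_NS(X; ℚ)₀ ⊗ ℝ`** — with
  A1-54's `degZeroHom : S ≅ 𝔤₀` this is the degree-`0` clause of (3.6) WITH ITS `ℚ`-STRUCTURE (`𝔤_NS(X; ℝ)₀ ≅ I ⊗ ℝ`, `I` the
  Lie ideal of `End⁰(X)` generated by `End⁰(X)^+`), where A1-54 alone had it for the `ℝ`-algebra `End(X) ⊗ ℝ`;
  `finrank_symmProdSpan_endAlgReal : dim_ℝ S = dim_ℚ I`; the summands `finrank_neronSeveri_degTwo/degMinusTwo : dim 𝔤_{±2} =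
  ρ(X)`, `finrank_neronSeveri_degZero : dim 𝔤₀ = dim_ℚ I`; and the count
  **`IsRiemannForm.finrank_neronSeveriLieAlgebra : dim_ℝ 𝔤_NS(X; ℝ) = 2ρ(X) + dim_ℚ I`**,
  **`IsRiemannForm.finrank_neronSeveriLieAlgebra_add_finrank_rosatiAntiInvariants :
  dim_ℝ 𝔤_NS(X; ℝ) + dim_ℚ 𝔲(X) = 2ρ(X) + dim_ℚ End⁰(X)`** (`IsAbelianVariety.` form), the bounds
  `3ρ(X) ≤ dim_ℝ 𝔤_NS(X; ℝ) ≤ 2ρ(X) + dim_ℚ End⁰(X)`, and the commutative case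
  **`IsRiemannForm.finrank_neronSeveriLieAlgebra_of_forall_mul_comm : dim_ℝ 𝔤_NS(X; ℝ) = 3ρ(X)`** (e.g. `End⁰(X) = ℚ`: `ρ = 1`,
  `𝔤_NS(X; ℝ) = 𝔰𝔩₂(ℝ)` of the polarization, dimension `3`; LL's table (3.8), totally real multiplication, `m = 1`).
* §5 (junction with A1-50): `sigmaMap (sharp hnd) = sigma hnd` (the two `σ_λ` agree, definitionally), `rosatiAdj_sharp_eq_self_iff`
  / `symmPart_sharp_eq` / `symmPart_sharp_top` (A1-54's `†`-symmetric part for `P₀ = κ♭⁻¹` is A1-50's `rosatiInvariants κ`),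
  `formsOf_sharp_top`, and `coe_formsOfEquivSymmPart_sharp` (the two formalised (3.5)-isomorphisms have the same map `λ ↦ σ_λ`).

## Proof notes

The direct-sum statement is LL's "`𝔤 = 𝔤_{-2} ⊕ 𝔤_0 ⊕ 𝔤_2`" read on the `2 × 2` block form of `𝔰𝔬(V ⊕ V^*)` (an element
`ψ₋₂(βκ⁻¹) + ψ₀(s^*) + ψ₂(κα)` vanishes only if `β = s = α = 0`; row A1-55's §6b has the same computation inside A1-54's
file, re-derived privately here so that this leaf elaborates against either build of its parent).  The base change is the
standard "a `ℚ`-basis is an `ℝ`-basis of the real span" (Beauville's "`rk_ℤ End(A) = dim_ℝ End(A) ⊗ ℝ`"), done once for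
rational matrices and transported: to `End_ℝ(V)` along `M ↦ Φ M Φ⁻¹` (Lange's `ρ_r ⊗ 1`), and to `⋀²V^*` along the Gram matrix
on the lattice basis (`latticeGram`, which is `ratGram ⊗ ℝ` on `NS_ℚ(X)`).  `S = span_ℝ ρ(I)` is `span(𝒜^+·𝒜^+) =
span_ℝ ρ(End⁰(X)^+) · span_ℝ ρ(End⁰(X)^+) = span_ℝ ρ(End⁰(X)^+ · End⁰(X)^+) = span_ℝ ρ(span_ℚ(End⁰(X)^+ · End⁰(X)^+)) =
span_ℝ ρ(I)` (`ρ` multiplicative and `ℚ`-linear, A1-53's `rosatiSymmIdeal_eq_span_mul`).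

## SCOPE NOTES (what is NOT claimed)

(a) As rows A1-54/A1-55: `𝔤_NS(X; ℝ)` is the REAL Lie algebra; the `ℚ`-FORM `𝔤_NS(X; ℚ) ⊆ 𝔤𝔩(H•(X; ℚ))` of (1.9) "It is defined
over `ℚ`" is not constructed here — what is proved is that the three real summands have the `ℚ`-structures `NS_ℚ(X)`, `I`,
`NS_ℚ(X)` of the printed statement (as real spans of rational objects of the right `ℚ`-dimension), which is the dimension-level
content of (3.6); `dim_ℚ 𝔤_NS(X; ℚ)₀` MEANS `dim_ℚ I`, `I = rosatiSymmIdeal Φ G₀` (A1-53's reading of `𝔤_NS(X; ℚ)₀` in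
"`End⁰(X) = 𝔤_NS(X; ℚ)_0 × 𝔲(X)`").  (b) The per-type table (3.7)/(3.8) (p0015 L81 – p0016 L57: `𝔰𝔭(2m)`, `𝔰𝔭(4m)`, `𝔰𝔬(4m)`,
`𝔰𝔩(2md)` forms by Albert type) is NOT formalised; only the type-free count that (3.6) implies, and its commutative special
case.  (c) No statement about (semi)simplicity is made here (that is A1-55).  (d) Hypotheses: §3 none beyond the torus; §4 a
polarization `IsRiemannForm Φ η₀` with a rational Gram matrix `G₀` (`G₀ ⊗ ℝ = latticeGram Φ η₀`; one exists,
`IsRiemannForm.exists_ratMatrix_latticeGram_isUnit`) and, for the `_aux` forms, an inverse `P₀` of `η₀♭` (exists,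
`IsRiemannForm.exists_rinv`); `[Nontrivial E]` (`dim X > 0`) where A1-54's structure theorem needs it.

## References

* [LooijengaLunts1997] E. Looijenga, V. A. Lunts, *A Lie algebra attached to a projective variety*, Invent. Math. 129
  (1997), 361–412; arXiv:alg-geom/9604014. §2 (Jordan–Lefschetz pairs), §3 (3.2), (3.5), (3.6), (3.8).
* [Lange2023AbelianVarietiesComplex] H. Lange, *Abelian Varieties over the Complex Numbers*, Grundlehren Text Editions,
  Springer (2023). §1.1.2 Prop. 1.1.9, §1.3.1, §1.5.1, §2.4.2 Prop. 2.4.12.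
* [Beauville2014MaximalPicard] A. Beauville, *Some surfaces with maximal Picard number*, J. Éc. polytech. Math. 1 (2014),
  101–116. §3 Prop. 3 (proof).
* [Lang2002] S. Lang, *Algebra*, 3rd ed., GTM 211, Springer (2002). Ch. III §5, XVI §4.
-/

noncomputable section

open Module Function
open scoped Matrix
open Literature.LinearAlgebra.Alternating

namespace Literature.Geometry.Kaehler

namespace ComplexTorus

/-! ### §1 The abstract model of row A1-54: the three blocks are independent; `dim 𝔤(𝔞(𝒜), H•(X)) = 2·dim 𝔞(𝒜) + dim S` -/

section ModelDimension

variable {E : Type*} [NormedAddCommGroup E] [NormedSpace ℂ E] [FiniteDimensional ℂ E]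
  {κ : E [⋀^Fin 2]→L[ℝ] ℝ} {P₀ : (E →L[ℝ] ℝ) →ₗ[ℝ] E} {𝒜 : Subalgebra ℝ (E →ₗ[ℝ] E)}

/-- **`S = 𝒜^+ · 𝒜^+`**: the span `S` of the products of two `†`-symmetric elements is the product of the subspaces
`𝒜^+` and `𝒜^+` of the algebra `End(V)` (Mathlib's `Submodule` multiplication). [cite: LooijengaLunts1997, §3 (3.6)] -/
theorem symmProdSpan_eq_mul : symmProdSpan κ P₀ 𝒜 = symmPart κ P₀ 𝒜 * symmPart κ P₀ 𝒜 := by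
  rw [symmProdSpan, Submodule.mul_eq_span_mul_set]
  refine congrArg _ (Set.ext fun c ↦ ⟨?_, ?_⟩)
  · rintro ⟨a, ha, b, hb, rfl⟩
    exact Set.mul_mem_mul ha hb
  · rintro ⟨a, ha, b, hb, rfl⟩
    exact ⟨a, ha, b, hb, rfl⟩

variable (h₁ : flat κ ∘ₗ P₀ = 1)
include h₁

/-- The three blocks are independent: `ψ₋₂(βκ⁻¹) + ψ₀(s^*) + ψ₂(κα) = 0 ⇒ β = s = α = 0` (entries of the `2 × 2` block
form of `𝔰𝔬(V ⊕ V^*)`; `κ♭` injective, `κ⁻¹` onto).  Row A1-55's §6b proves the same lemma inside A1-54's file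
(`eq_zero_of_blocks_eq_zero`); it is re-derived here so that this file elaborates against either build of its parent.
[cite: LooijengaLunts1997, §3 (3.1)–(3.2) (the block form of 𝔰𝔬(V ⊕ V^*))] -/
private theorem blocks_eq_zero₇ {β s α : E →ₗ[ℝ] E} (h : lowMap P₀ β + midMap E s + upMap κ α = 0) :
    β = 0 ∧ s = 0 ∧ α = 0 := by
  have hlow : ∀ ξ : E →L[ℝ] ℝ, β (P₀ ξ) = 0 := fun ξ ↦ by
    have e := congrArg (fun T : Module.End ℝ (sumDual E) ↦ (T ((0 : E), ξ)).1) h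
    simpa [lowEnd_apply, psi0_apply, dualTranspose_transposeEnd, upMap_apply] using e
  have hmid : ∀ x : E, s x = 0 := fun x ↦ by
    have e := congrArg (fun T : Module.End ℝ (sumDual E) ↦ (T (x, (0 : E →L[ℝ] ℝ))).1) h
    simpa [lowEnd_apply, psi0_apply, dualTranspose_transposeEnd, upMap_apply] using e
  have hup : ∀ x : E, flat κ (α x) = 0 := fun x ↦ by
    have e := congrArg (fun T : Module.End ℝ (sumDual E) ↦ (T (x, (0 : E →L[ℝ] ℝ))).2) h
    simpa [lowEnd_apply, psi0_apply, dualTranspose_transposeEnd, upMap_apply] using e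
  refine ⟨LinearMap.ext fun x ↦ ?_, LinearMap.ext hmid, LinearMap.ext fun x ↦ ?_⟩
  · rw [← rinv_flat h₁ x, LinearMap.zero_apply]
    exact hlow _
  · rw [← rinv_flat h₁ (α x), hup, map_zero, LinearMap.zero_apply]

/-- `α ↦ ψ₂(κ(α ·, ·))` is injective (`κ` non-degenerate). [cite: LooijengaLunts1997, §3 (3.2) ("a graded Lie algebra isomorphism")] -/
theorem upMap_injective : Injective (upMap κ) :=
  (injective_iff_map_eq_zero _).2 fun α h ↦ by
    have h' : lowMap P₀ 0 + midMap E 0 + upMap κ α = 0 := by rw [map_zero, map_zero, add_zero, zero_add, h]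
    exact (blocks_eq_zero₇ h₁ h').2.2

/-- `β ↦ ψ₋₂(β κ⁻¹)` is injective (`κ⁻¹ = P₀` is onto). [cite: LooijengaLunts1997, §3 (3.2)] -/
theorem lowMap_injective : Injective (lowMap P₀) :=
  (injective_iff_map_eq_zero _).2 fun β h ↦ by
    have h' : lowMap P₀ β + midMap E 0 + upMap κ 0 = 0 := by rw [map_zero, map_zero, add_zero, add_zero, h]
    exact (blocks_eq_zero₇ h₁ h').1

/-- `dim ψ₂(κ𝒜^+) = dim 𝒜^+`. [cite: LooijengaLunts1997, §3 (3.6)] -/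
theorem finrank_upPiece : finrank ℝ (upPiece κ P₀ 𝒜) = finrank ℝ (symmPart κ P₀ 𝒜) :=
  (Submodule.equivMapOfInjective _ (upMap_injective h₁) (symmPart κ P₀ 𝒜)).finrank_eq.symm

/-- `dim ψ₋₂(𝒜^+κ⁻¹) = dim 𝒜^+`. [cite: LooijengaLunts1997, §3 (3.6)] -/
theorem finrank_lowPiece : finrank ℝ (lowPiece κ P₀ 𝒜) = finrank ℝ (symmPart κ P₀ 𝒜) :=
  (Submodule.equivMapOfInjective _ (lowMap_injective h₁) (symmPart κ P₀ 𝒜)).finrank_eq.symm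

omit h₁ in
/-- `dim ψ₀(S^*) = dim S`. [cite: LooijengaLunts1997, §3 (3.6)] -/
theorem finrank_midPiece : finrank ℝ (midPiece κ P₀ 𝒜) = finrank ℝ (symmProdSpan κ P₀ 𝒜) :=
  (Submodule.equivMapOfInjective _ midMap_injective (symmProdSpan κ P₀ 𝒜)).finrank_eq.symm

/-- The degree-`-2` and degree-`0` blocks meet in `0`. [cite: LooijengaLunts1997, §2 ("𝔤 = 𝔤_{-2} ⊕ 𝔤_0 ⊕ 𝔤_2"), §3 (3.6)] -/
theorem disjoint_lowPiece_midPiece : Disjoint (lowPiece κ P₀ 𝒜) (midPiece κ P₀ 𝒜) := by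
  rw [Submodule.disjoint_def]
  rintro x ⟨β, hβ, rfl⟩ hx
  obtain ⟨s, hs, hsx⟩ := Submodule.mem_map.1 hx
  have h' : lowMap P₀ β + midMap E (-s) + upMap κ 0 = 0 := by
    rw [map_neg, hsx, map_zero, add_zero, add_neg_cancel]
  rw [(blocks_eq_zero₇ h₁ h').1, map_zero]

/-- The degree-`2` block meets `𝔤₋₂ ⊕ 𝔤₀` in `0`: **the model is the DIRECT sum `ψ₋₂(𝒜^+κ⁻¹) ⊕ ψ₀(S^*) ⊕ ψ₂(κ𝒜^+)`**
("If `(𝔤, h)` is a Jordan–Lefschetz pair, then `𝔤 = 𝔤_{-2} ⊕ 𝔤_0 ⊕ 𝔤_2`" — here read off the `2 × 2` block form).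
[cite: LooijengaLunts1997, §2 ("𝔤 = 𝔤_{-2} ⊕ 𝔤_0 ⊕ 𝔤_2"), §3 (3.6)] -/
theorem disjoint_lowPiece_sup_midPiece_upPiece :
    Disjoint (lowPiece κ P₀ 𝒜 ⊔ midPiece κ P₀ 𝒜) (upPiece κ P₀ 𝒜) := by
  rw [Submodule.disjoint_def]
  intro x hx hx'
  obtain ⟨_, ⟨β, hβ, rfl⟩, _, ⟨s, hs, rfl⟩, rfl⟩ := Submodule.mem_sup.1 hx
  obtain ⟨α, hα, hαx⟩ := Submodule.mem_map.1 hx'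
  have h' : lowMap P₀ β + midMap E s + upMap κ (-α) = 0 := by
    rw [map_neg, hαx, add_neg_cancel]
  obtain ⟨hb, hs0, -⟩ := blocks_eq_zero₇ h₁ h'
  rw [hb, hs0, map_zero, map_zero, add_zero]

omit h₁ in
/-- `dim(s ⊔ t) = dim s + dim t` for disjoint subspaces (plumbing, Mathlib's `Submodule.finrank_sup_add_finrank_inf_eq`).
[cite: Lang2002, III §5 (dimension of a direct sum)] -/
private theorem finrank_sup_of_disjoint₇ {V : Type*} [AddCommGroup V] [Module ℝ V] [FiniteDimensional ℝ V]
    {s t : Submodule ℝ V} (h : Disjoint s t) : finrank ℝ ↥(s ⊔ t) = finrank ℝ s + finrank ℝ t := by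
  have e := Submodule.finrank_sup_add_finrank_inf_eq s t
  rwa [h.eq_bot, finrank_bot, add_zero] at e

/-- **`dim model = 2·dim 𝒜^+ + dim S`** (direct sum of the three blocks, each block map injective). [cite: LooijengaLunts1997, §3 (3.6)] -/
theorem finrank_model :
    finrank ℝ (model κ P₀ 𝒜) = 2 * finrank ℝ (symmPart κ P₀ 𝒜) + finrank ℝ (symmProdSpan κ P₀ 𝒜) := by
  have e1 := finrank_sup_of_disjoint₇ (V := Module.End ℝ (sumDual E))
    (disjoint_lowPiece_sup_midPiece_upPiece h₁ (𝒜 := 𝒜))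
  have e2 := finrank_sup_of_disjoint₇ (V := Module.End ℝ (sumDual E)) (disjoint_lowPiece_midPiece h₁ (𝒜 := 𝒜))
  rw [model, e1, e2, finrank_lowPiece h₁, finrank_midPiece, finrank_upPiece h₁]
  ring

variable (h𝒜 : ∀ a ∈ 𝒜, rosatiAdj κ P₀ a ∈ 𝒜)

/-- `ρ` is injective on the model (`⊆ 𝔰𝔬(V ⊕ V^*)`, row A1-43's `spinorRep_injective`), so `dim ρ(model) = dim model`.
[cite: LooijengaLunts1997, §3 (3.2) ("ρ … is injective"), (3.6)] -/
theorem finrank_llModel_eq [Nontrivial E] : finrank ℝ (llModel h₁ h𝒜) = finrank ℝ (model κ P₀ 𝒜) := by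
  have hinj : Injective ((spinorRepLin E).domRestrict (model κ P₀ 𝒜)) := fun x y h ↦
    Subtype.ext (eq_of_spinorRepLin_eq (model_le_so h₁ x.2) (model_le_so h₁ y.2) h)
  rw [← LinearMap.finrank_range_of_inj hinj, LinearMap.range_domRestrict]
  rfl

/-- **`dim 𝔤(𝔞(𝒜), H•(X)) = 2·dim 𝒜^+ + dim S`** for the image `llModel = ρ(model)`. [cite: LooijengaLunts1997, §3 (3.6)] -/
theorem finrank_llModel [Nontrivial E] :
    finrank ℝ (llModel h₁ h𝒜) = 2 * finrank ℝ (symmPart κ P₀ 𝒜) + finrank ℝ (symmProdSpan κ P₀ 𝒜) := by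
  rw [finrank_llModel_eq h₁ h𝒜, finrank_model h₁]

include h𝒜 in
/-- **`dim 𝔤(𝔞(𝒜)) = 2·dim 𝔞(𝒜) + dim S`** — the dimension count of the structure theorem (3.6) at the level of an
arbitrary `†`-stable real subalgebra `𝒜 ⊆ End(V)` (`𝔞(𝒜) ≅ 𝒜^+`, (3.5): row A1-54's `formsOfEquivSymmPart`; `𝔤(𝔞(𝒜)) = ρ(model)`,
`llAlgebra_formsOf_eq`). [cite: LooijengaLunts1997, §3 (3.5)] [cite: LooijengaLunts1997, §3 (3.6)] -/
theorem finrank_llAlgebra_formsOf [Nontrivial E] :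
    finrank ℝ (llAlgebra E (formsOf P₀ 𝒜)) = 2 * finrank ℝ (formsOf P₀ 𝒜) + finrank ℝ (symmProdSpan κ P₀ 𝒜) := by
  rw [llAlgebra_formsOf_eq h₁ h𝒜, finrank_llModel h₁ h𝒜, (formsOfEquivSymmPart h₁ (𝒜 := 𝒜)).finrank_eq]

/-- **`dim 𝔤₂ = dim 𝔞(𝒜)`** ("Its degree `2` summand is canonically isomorphic to" `𝔞`: row A1-54's `degTwoEquiv`). [cite: LooijengaLunts1997, §3 (3.6)] -/
theorem finrank_map_upPiece [Nontrivial E] :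
    finrank ℝ ((upPiece κ P₀ 𝒜).map (spinorRepLin E)) = finrank ℝ (formsOf P₀ 𝒜) :=
  (degTwoEquiv h₁ (𝒜 := 𝒜)).finrank_eq.symm

/-- **`dim 𝔤₋₂ = dim 𝔞(𝒜)`** (`𝔤₋₂ = ρψ₋₂(𝒜^+κ⁻¹) ≅ 𝒜^+ ≅ 𝔞(𝒜)`). [cite: LooijengaLunts1997, §3 (3.6)] -/
theorem finrank_map_lowPiece [Nontrivial E] :
    finrank ℝ ((lowPiece κ P₀ 𝒜).map (spinorRepLin E)) = finrank ℝ (formsOf P₀ 𝒜) := by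
  have hinj : Injective ((spinorRepLin E).domRestrict (lowPiece κ P₀ 𝒜)) := fun x y h ↦
    Subtype.ext (eq_of_spinorRepLin_eq (model_le_so h₁ (Submodule.mem_sup_left (Submodule.mem_sup_left x.2)))
      (model_le_so h₁ (Submodule.mem_sup_left (Submodule.mem_sup_left y.2))) h)
  rw [← LinearMap.range_domRestrict, LinearMap.finrank_range_of_inj hinj, finrank_lowPiece h₁,
    (formsOfEquivSymmPart h₁ (𝒜 := 𝒜)).finrank_eq]

/-- **`dim 𝔤₀ = dim S`** ("Its degree `0` summand can be identified with the Lie ideal … generated by" `𝒜^+`: row A1-54's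
`degZeroHom`, `mem_range_degZeroHom_iff`). [cite: LooijengaLunts1997, §3 (3.6)] -/
theorem finrank_map_midPiece [Nontrivial E] :
    finrank ℝ ((midPiece κ P₀ 𝒜).map (spinorRepLin E)) = finrank ℝ (symmProdSpan κ P₀ 𝒜) := by
  have hinj : Injective ((spinorRepLin E).domRestrict (midPiece κ P₀ 𝒜)) := fun x y h ↦
    Subtype.ext (eq_of_spinorRepLin_eq (model_le_so h₁ (Submodule.mem_sup_left (Submodule.mem_sup_right x.2)))
      (model_le_so h₁ (Submodule.mem_sup_left (Submodule.mem_sup_right y.2))) h)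
  rw [← LinearMap.range_domRestrict, LinearMap.finrank_range_of_inj hinj, finrank_midPiece]

end ModelDimension

/-! ### §2 Base change `ℚ ⊂ ℝ`: a `ℚ`-basis of rational matrices stays an `ℝ`-basis -/

section BaseChange

variable {ι : Type*} [Fintype ι]

/-- **`ℚ`-linearly independent rational matrices stay `ℝ`-linearly independent** after `A ↦ A ⊗ ℝ` (flatten `M_ι(ℚ) ≅ ℚ^{ι×ι}`
and use Mathlib's `linearIndependent_algebraMap_comp_iff`; the tree's `ComplexTorusMaximalPicardNumberCM` has this privately).
[cite: Beauville2014MaximalPicard, §3 Prop. 3 (proof: rk End(A) = dim_ℝ End(A) ⊗ ℝ)] [cite: Lang2002, XVI §4 (extension of the base)] -/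
theorem linearIndependent_matrix_map_ratCast {N : Type*} {f : N → Matrix ι ι ℚ} (hf : LinearIndependent ℚ f) :
    LinearIndependent ℝ (fun l ↦ (f l).map ((↑) : ℚ → ℝ)) := by
  let flatQ : Matrix ι ι ℚ →ₗ[ℚ] (ι × ι → ℚ) :=
    { toFun := fun A p ↦ A p.1 p.2, map_add' := fun _ _ ↦ rfl, map_smul' := fun _ _ ↦ rfl }
  let flatR : Matrix ι ι ℝ →ₗ[ℝ] (ι × ι → ℝ) :=
    { toFun := fun A p ↦ A p.1 p.2, map_add' := fun _ _ ↦ rfl, map_smul' := fun _ _ ↦ rfl }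
  have hker : LinearMap.ker flatQ = ⊥ :=
    LinearMap.ker_eq_bot.2 fun A B h ↦ Matrix.ext fun i j ↦ congr_fun h (i, j)
  have h1 : LinearIndependent ℚ (fun l ↦ flatQ (f l)) := hf.map' flatQ hker
  have h2 : LinearIndependent ℝ (fun l ↦ algebraMap ℚ ℝ ∘ flatQ (f l)) :=
    (linearIndependent_algebraMap_comp_iff (S := ℝ)).2 h1
  have h3 : (fun l ↦ algebraMap ℚ ℝ ∘ flatQ (f l)) = flatR ∘ (fun l ↦ (f l).map ((↑) : ℚ → ℝ)) := by
    funext l p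
    simp [flatQ, flatR]
  rw [h3] at h2
  exact h2.of_comp _

omit [Fintype ι] in
/-- `(r A) ⊗ ℝ = r (A ⊗ ℝ)` for a rational scalar (plumbing). [cite: Lang2002, XVI §4] -/
theorem matrix_map_ratCast_smul (r : ℚ) (A : Matrix ι ι ℚ) :
    (r • A).map ((↑) : ℚ → ℝ) = (r : ℝ) • A.map ((↑) : ℚ → ℝ) := by
  ext i j
  simp [Matrix.map_apply]

/-- **Base change `ℚ ⊂ ℝ`: `dim_ℝ (N ⊗ ℝ) = dim_ℚ N`.** For a finite-dimensional `ℚ`-space `N` realised in rational matrices by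
an injective `ℚ`-linear `g : N → M_ι(ℚ)`, and any injective `ℝ`-linear `T : M_ι(ℝ) → W`, the real span of `T(g(N) ⊗ ℝ)` has
real dimension `dim_ℚ N` (a `ℚ`-basis of `N` maps to an `ℝ`-basis of the span: "`rk_ℤ End(A) = dim_ℝ End(A) ⊗_ℤ ℝ`").
[cite: Beauville2014MaximalPicard, §3 Prop. 3 (proof: rk End(A) = dim_ℝ End(A) ⊗ ℝ)] [cite: Lang2002, XVI §4 (extension of the base)] -/
theorem finrank_span_range_map_ratCast {N : Type*} [AddCommGroup N] [Module ℚ N] [FiniteDimensional ℚ N]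
    {W : Type*} [AddCommGroup W] [Module ℝ W] (g : N →ₗ[ℚ] Matrix ι ι ℚ) (hg : Injective g)
    (T : Matrix ι ι ℝ →ₗ[ℝ] W) (hT : Injective T) :
    finrank ℝ (Submodule.span ℝ (Set.range fun n : N ↦ T ((g n).map ((↑) : ℚ → ℝ)))) = finrank ℚ N := by
  classical
  let b := Module.finBasis ℚ N
  let f : Fin (finrank ℚ N) → Matrix ι ι ℚ := fun l ↦ g (b l)
  have hfli : LinearIndependent ℚ f := b.linearIndependent.map' g (LinearMap.ker_eq_bot.2 hg)
  have hR : LinearIndependent ℝ (fun l ↦ T ((f l).map ((↑) : ℚ → ℝ))) :=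
    (linearIndependent_matrix_map_ratCast hfli).map' T (LinearMap.ker_eq_bot.2 hT)
  have castM_sum : ∀ X : Fin (finrank ℚ N) → Matrix ι ι ℚ,
      (∑ l, X l).map ((↑) : ℚ → ℝ) = ∑ l, (X l).map ((↑) : ℚ → ℝ) := fun X ↦
    map_sum ((Rat.castHom ℝ).mapMatrix : Matrix ι ι ℚ →+* Matrix ι ι ℝ) X Finset.univ
  have hspan : Submodule.span ℝ (Set.range fun n : N ↦ T ((g n).map ((↑) : ℚ → ℝ))) =
      Submodule.span ℝ (Set.range fun l ↦ T ((f l).map ((↑) : ℚ → ℝ))) := by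
    refine le_antisymm (Submodule.span_le.2 ?_) (Submodule.span_mono ?_)
    · rintro _ ⟨n, rfl⟩
      have hsum : g n = ∑ l, b.repr n l • f l := by
        conv_lhs => rw [← b.sum_repr n]
        rw [map_sum]
        exact Finset.sum_congr rfl fun l _ ↦ map_smul g _ _
      show T ((g n).map ((↑) : ℚ → ℝ)) ∈ _
      rw [hsum, castM_sum, map_sum]
      refine Submodule.sum_mem _ fun l _ ↦ ?_
      rw [matrix_map_ratCast_smul, map_smul]
      exact Submodule.smul_mem _ _ (Submodule.subset_span ⟨l, rfl⟩)
    · rintro _ ⟨l, rfl⟩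
      exact ⟨b l, rfl⟩
  rw [hspan, finrank_span_eq_card hR, Fintype.card_fin]

end BaseChange

/-! ### §3 The torus: `End(X) ⊗ ℝ`, `NS(X) ⊗ ℝ` and their rational structures -/

section TorusRat

variable {ι : Type*} [Fintype ι] [DecidableEq ι] {E : Type*} [NormedAddCommGroup E] [NormedSpace ℂ E]
  (Φ : (ι → ℝ) ≃L[ℝ] E)

/-- **The realified analytic representation `M ↦ Φ ∘ M ∘ Φ⁻¹` is an injective `ℝ`-linear map `M_ι(ℝ) → End_ℝ(V)`** (Lange's
`ρ_r ⊗ 1`, faithful; packaged as an existence statement to keep this file definition-free).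
[cite: Lange2023AbelianVarietiesComplex, §1.1.2 Prop. 1.1.9] -/
theorem exists_linearMap_analyticRepReal :
    ∃ T : Matrix ι ι ℝ →ₗ[ℝ] (E →ₗ[ℝ] E), Injective T ∧
      ∀ M, T M = ((analyticRepReal Φ Φ M : E →L[ℝ] E) : E →ₗ[ℝ] E) := by
  let T : Matrix ι ι ℝ →ₗ[ℝ] (E →ₗ[ℝ] E) :=
    { toFun := fun M ↦ ((analyticRepReal Φ Φ M : E →L[ℝ] E) : E →ₗ[ℝ] E)
      map_add' := fun M M' ↦ by rw [analyticRepReal_add]; rfl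
      map_smul' := fun r M ↦ by rw [analyticRepReal_smul]; rfl }
  refine ⟨T, fun M M' h ↦ ?_, fun M ↦ rfl⟩
  refine Matrix.toLin'.injective (LinearMap.ext fun x ↦ ?_)
  have e : ((analyticRepReal Φ Φ M : E →L[ℝ] E) : E →ₗ[ℝ] E) (Φ x) =
      ((analyticRepReal Φ Φ M' : E →L[ℝ] E) : E →ₗ[ℝ] E) (Φ x) := congrArg (fun S : E →ₗ[ℝ] E ↦ S (Φ x)) h
  rw [ContinuousLinearMap.coe_coe, ContinuousLinearMap.coe_coe, analyticRepReal_apply, analyticRepReal_apply] at e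
  rw [Matrix.toLin'_apply, Matrix.toLin'_apply]
  exact Φ.injective e

/-- `ρ(q A) = q ρ(A)` for `q ∈ ℚ`: `ρ : End_ℚ(X) → End_ℝ(V)` is `ℚ`-linear. [cite: Lange2023AbelianVarietiesComplex, §1.1.2 Prop. 1.1.9] -/
theorem rhoR_ratCast_smul (q : ℚ) (A : Matrix ι ι ℚ) : rhoR Φ (q • A) = (q : ℝ) • rhoR Φ A := by
  rw [rhoR_apply, rhoR_apply, matrix_map_ratCast_smul, analyticRepReal_smul]
  rfl

/-- **`ρ : M_ι(ℚ) → End_ℝ(V)`, `A ↦ Φ ∘ (A ⊗ ℝ) ∘ Φ⁻¹`, is injective** (the rational representation is faithful).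
[cite: Lange2023AbelianVarietiesComplex, §1.1.2 Prop. 1.1.9] [cite: LooijengaLunts1997, §3 ("We think of End⁰(X) as a subalgebra of End(V_ℚ)")] -/
theorem rhoR_injective : Injective (rhoR Φ) := fun A B h ↦ by
  obtain ⟨T, hT, hTe⟩ := exists_linearMap_analyticRepReal Φ
  rw [rhoR_apply, rhoR_apply, ← hTe, ← hTe] at h
  exact Matrix.map_injective Rat.cast_injective (hT h)

/-- **`dim_ℝ (N ⊗ ℝ) = dim_ℚ N` for a `ℚ`-subspace `N ⊆ M_ι(ℚ)` realised as `span_ℝ ρ(N) ⊆ End_ℝ(V)`** (e.g. `N = End⁰(X)`,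
`End⁰(X)^+`, `𝔤_NS(X; ℚ)₀`). [cite: Beauville2014MaximalPicard, §3 Prop. 3 (proof: rk End(A) = dim_ℝ End(A) ⊗ ℝ)] [cite: Lang2002, XVI §4 (extension of the base)] -/
theorem finrank_span_rhoR_image (N : Submodule ℚ (Matrix ι ι ℚ)) :
    finrank ℝ (Submodule.span ℝ (rhoR Φ '' (N : Set (Matrix ι ι ℚ)))) = finrank ℚ N := by
  obtain ⟨T, hT, hTe⟩ := exists_linearMap_analyticRepReal Φ
  have hset : rhoR Φ '' (N : Set (Matrix ι ι ℚ)) = Set.range fun n : N ↦ T ((N.subtype n).map ((↑) : ℚ → ℝ)) := by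
    ext x
    simp only [Set.mem_image, SetLike.mem_coe, Set.mem_range, Submodule.subtype_apply, hTe, rhoR_apply]
    exact ⟨fun ⟨A, hA, h⟩ ↦ ⟨⟨A, hA⟩, h⟩, fun ⟨n, h⟩ ↦ ⟨n, n.2, h⟩⟩
  rw [hset, finrank_span_range_map_ratCast N.subtype Subtype.val_injective T hT]

/-- `ρ` on the type `End⁰(X) = ↥(endAlgRat Φ)`: the image of a `ℚ`-subspace `N ⊆ End⁰(X)` is the image of its copy in `M_ι(ℚ)`
(plumbing between row A1-53's carrier and row A1-54's `rhoR`). [cite: LooijengaLunts1997, §3 ("We think of End⁰(X) as a subalgebra of End(V_ℚ)")] -/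
theorem image_rhoR_coe (N : Submodule ℚ (endAlgRat Φ)) :
    (fun A : endAlgRat Φ ↦ rhoR Φ A) '' (N : Set (endAlgRat Φ)) =
      rhoR Φ '' (N.map (endAlgRat Φ).val.toLinearMap : Set (Matrix ι ι ℚ)) := by
  ext x
  simp only [Set.mem_image, SetLike.mem_coe, Submodule.mem_map, AlgHom.toLinearMap_apply, Subalgebra.coe_val]
  constructor
  · rintro ⟨A, hA, rfl⟩
    exact ⟨A, ⟨A, hA, rfl⟩, rfl⟩
  · rintro ⟨_, ⟨A, hA, rfl⟩, rfl⟩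
    exact ⟨A, hA, rfl⟩

/-- The same for a `ℚ`-subspace `N ⊆ End⁰(X)` given on the TYPE `End⁰(X) = ↥(endAlgRat Φ)` (the carrier of row A1-53's
`rosatiSymm`, `rosatiSymmIdeal`, `rosatiAntiInvariants`): `dim_ℝ span_ℝ ρ(N) = dim_ℚ N`. [cite: Beauville2014MaximalPicard, §3 Prop. 3 (proof: rk End(A) = dim_ℝ End(A) ⊗ ℝ)] [cite: Lang2002, XVI §4 (extension of the base)] -/
theorem finrank_span_rhoR_image_coe (N : Submodule ℚ (endAlgRat Φ)) :
    finrank ℝ (Submodule.span ℝ ((fun A : endAlgRat Φ ↦ rhoR Φ A) '' (N : Set (endAlgRat Φ)))) = finrank ℚ N := by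
  rw [image_rhoR_coe, finrank_span_rhoR_image,
    ← (Submodule.equivMapOfInjective _ (Subtype.val_injective : Injective (endAlgRat Φ).val.toLinearMap) N).finrank_eq]

/-- **`dim_ℝ End(X) ⊗ ℝ = dim_ℚ End⁰(X)`**: row A1-54's `End(X) ⊗ ℝ = endAlgReal Φ = span_ℝ ρ(End_ℚ(X))` has real dimension
`dim_ℚ End_ℚ(X)` (so it IS a model of the tensor product `End⁰(X) ⊗_ℚ ℝ`, cf. A1-54's SCOPE (d)).
[cite: LooijengaLunts1997, §3 ("End⁰(X) = End(X) ⊗ ℚ … (End(X) ⊗ ℝ)")] [cite: Beauville2014MaximalPicard, §3 Prop. 3 (proof: rk End(A) = dim_ℝ End(A) ⊗ ℝ)] [cite: Lang2002, XVI §4 (extension of the base)] -/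
theorem finrank_endAlgReal : finrank ℝ (endAlgReal Φ) = finrank ℚ (endAlgRat Φ) := by
  rw [← Subalgebra.finrank_toSubmodule, endAlgReal_toSubmodule, ← Subalgebra.finrank_toSubmodule (endAlgRat Φ)]
  exact finrank_span_rhoR_image Φ (Subalgebra.toSubmodule (endAlgRat Φ))

omit [DecidableEq ι] in
/-- The Gram matrix on the lattice basis is additive in the form (plumbing). [cite: Lange2023AbelianVarietiesComplex, §1.5.1] -/
private theorem latticeGram_add₇ [DecidableEq ι] (θ θ' : E [⋀^Fin 2]→L[ℝ] ℝ) :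
    latticeGram Φ (θ + θ') = latticeGram Φ θ + latticeGram Φ θ' := by
  ext i j
  simp [latticeGram_apply]

omit [DecidableEq ι] in
/-- The Gram matrix on the lattice basis is homogeneous in the form (plumbing). [cite: Lange2023AbelianVarietiesComplex, §1.5.1] -/
private theorem latticeGram_smul₇ [DecidableEq ι] (r : ℝ) (θ : E [⋀^Fin 2]→L[ℝ] ℝ) :
    latticeGram Φ (r • θ) = r • latticeGram Φ θ := by
  ext i j
  simp [latticeGram_apply]

/-- **`dim_ℝ NS(X) ⊗ ℝ = dim_ℚ NS_ℚ(X)`**: row A1-54's `NS(X) ⊗ ℝ = neronSeveriR Φ = span_ℝ NS_ℚ(X) ⊆ H²(X; ℝ)` has real dimension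
`dim_ℚ NS_ℚ(X)` — through the rational Gram matrices on the lattice basis (`latticeGram = ratGram ⊗ ℝ` on `NS_ℚ(X)`, row A2-31's
`map_ratGram`, `eq_of_latticeGram_eq`, `eq_of_ratGram_eq`). [cite: LooijengaLunts1997, §1 (1.9) ("NS(X) … It is defined over ℚ"), §3 (3.6) ("NS(X) ⊗ ℚ")]
[cite: Lange2023AbelianVarietiesComplex, §1.5.1, §2.4.2 Prop. 2.4.12] -/
theorem finrank_neronSeveriR [FiniteDimensional ℂ E] : finrank ℝ (neronSeveriR Φ) = finrank ℚ (neronSeveriQ Φ) := by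
  let Γ : (E [⋀^Fin 2]→L[ℝ] ℝ) →ₗ[ℝ] Matrix ι ι ℝ :=
    { toFun := fun θ ↦ latticeGram Φ θ, map_add' := latticeGram_add₇ Φ, map_smul' := latticeGram_smul₇ Φ }
  have hΓ : Injective Γ := fun θ θ' h ↦ eq_of_latticeGram_eq Φ h
  let g : neronSeveriQ Φ →ₗ[ℚ] Matrix ι ι ℚ :=
    { toFun := fun η ↦ ratGram Φ (η : E [⋀^Fin 2]→L[ℝ] ℝ)
      map_add' := fun η η' ↦ ratGram_add Φ η.2 η'.2
      map_smul' := fun c η ↦ ratGram_smul Φ c η.2 }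
  have hg : Injective g := fun η η' h ↦ Subtype.ext (eq_of_ratGram_eq Φ η.2 η'.2 h)
  haveI : FiniteDimensional ℚ (neronSeveriQ Φ) := FiniteDimensional.of_injective g hg
  have key := finrank_span_range_map_ratCast (N := ↥(neronSeveriQ Φ)) (W := Matrix ι ι ℝ) g hg LinearMap.id
    injective_id
  simp only [LinearMap.id_coe, id_eq] at key
  have hmap : (neronSeveriR Φ).map Γ =
      Submodule.span ℝ (Set.range fun η : neronSeveriQ Φ ↦ (g η).map ((↑) : ℚ → ℝ)) := by
    rw [neronSeveriR, Submodule.map_span]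
    refine congrArg _ (Set.ext fun M ↦ ⟨?_, ?_⟩)
    · rintro ⟨η, hη, rfl⟩
      exact ⟨⟨η, hη⟩, by simp [g, Γ, map_ratGram Φ hη]⟩
    · rintro ⟨η, rfl⟩
      exact ⟨η, η.2, by simp [g, Γ, map_ratGram Φ η.2]⟩
  rw [(Submodule.equivMapOfInjective Γ hΓ (neronSeveriR Φ)).finrank_eq, hmap, key]

/-- **`dim_ℝ NS(X) ⊗ ℝ = ρ(X) = rk NS(X)`, the Picard number** (`dim_ℚ NS_ℚ(X) = dim_ℚ H²_Hodge(X) = rk NS(X)`: rows A2-31 /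
A4 `neronSeveriQEquivHodgeClasses`, `finrank_neronSeveriGroup_eq_finrank_hodgeClasses`).
[cite: LooijengaLunts1997, §3 (3.6)] [cite: Lange2023AbelianVarietiesComplex, §1.3.1, §2.4.2 Prop. 2.4.12] -/
theorem finrank_neronSeveriR_eq_finrank_neronSeveriGroup [FiniteDimensional ℂ E] :
    finrank ℝ (neronSeveriR Φ) = finrank ℤ (neronSeveriGroup Φ) := by
  rw [finrank_neronSeveriR, finrank_neronSeveriGroup_eq_finrank_hodgeClasses,
    (neronSeveriQEquivHodgeClasses Φ).finrank_eq]

end TorusRat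

/-! ### §4 THE ABELIAN VARIETY: `(End(X) ⊗ ℝ)^+ = End⁰(X)^+ ⊗ ℝ`, `S = 𝔤_NS(X; ℚ)₀ ⊗ ℝ`, and the dimension of
`𝔤_NS(X; ℝ)` -/

section TorusDimension

variable {ι : Type*} [Fintype ι] [DecidableEq ι] {E : Type*} [NormedAddCommGroup E] [NormedSpace ℂ E]
  [FiniteDimensional ℂ E] (Φ : (ι → ℝ) ≃L[ℝ] E) {η₀ : E [⋀^Fin 2]→L[ℝ] ℝ} {G₀ : Matrix ι ι ℚ}
  {P₀ : (E →L[ℝ] ℝ) →ₗ[ℝ] E}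

omit [FiniteDimensional ℂ E] in
/-- `span_ℝ ρ(span_ℚ P) = span_ℝ ρ(P)`: a `ℚ`-span is absorbed by the real span (`ρ` is additive and `ℚ`-homogeneous).
[cite: Lang2002, XVI §4 (extension of the base)] -/
theorem span_image_rhoR_coe_span (P : Set (endAlgRat Φ)) :
    Submodule.span ℝ ((fun A : endAlgRat Φ ↦ rhoR Φ A) '' (Submodule.span ℚ P : Set (endAlgRat Φ))) =
      Submodule.span ℝ ((fun A : endAlgRat Φ ↦ rhoR Φ A) '' P) := by
  refine le_antisymm (Submodule.span_le.2 ?_) (Submodule.span_mono (Set.image_mono Submodule.subset_span))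
  rintro _ ⟨C, hC, rfl⟩
  induction hC using Submodule.span_induction with
  | mem C hC => exact Submodule.subset_span ⟨C, hC, rfl⟩
  | zero =>
    show rhoR Φ ((0 : endAlgRat Φ) : Matrix ι ι ℚ) ∈ _
    rw [ZeroMemClass.coe_zero, map_zero]
    exact Submodule.zero_mem _
  | add C C' _ _ hC hC' =>
    show rhoR Φ ((C + C' : endAlgRat Φ) : Matrix ι ι ℚ) ∈ _
    rw [Subalgebra.coe_add, map_add]
    exact Submodule.add_mem _ hC hC'
  | smul q C _ hC =>
    show rhoR Φ ((q • C : endAlgRat Φ) : Matrix ι ι ℚ) ∈ _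
    rw [Subalgebra.coe_smul, rhoR_ratCast_smul]
    exact Submodule.smul_mem _ _ hC

variable (hη₀ : IsRiemannForm Φ η₀) (hG₀ : G₀.map ((↑) : ℚ → ℝ) = latticeGram Φ η₀) (h₁ : flat η₀ ∘ₗ P₀ = 1)

include hη₀ hG₀ h₁ in
/-- **`(End(X) ⊗ ℝ)^+ = End⁰(X)^+ ⊗ ℝ`**: row A1-54's `†`-symmetric part of `End(X) ⊗ ℝ` is the real span of `ρ(End⁰(X)^+)`,
`End⁰(X)^+ = rosatiSymm Φ G₀` the `+1`-eigenspace of the Rosati involution in row A1-53 (`= symmEndRat Φ G₀` of row A2-31,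
`map_val_rosatiSymm`; A1-54's `symmPart_endAlgReal_eq`). [cite: LooijengaLunts1997, §3 (3.5)–(3.6) ("End⁰(X)^± for the ±1-eigen space of †")] -/
theorem symmPart_endAlgReal_eq_span_rosatiSymm : symmPart η₀ P₀ (endAlgReal Φ) =
    Submodule.span ℝ ((fun A : endAlgRat Φ ↦ rhoR Φ A) '' (rosatiSymm Φ G₀ : Set (endAlgRat Φ))) := by
  rw [symmPart_endAlgReal_eq Φ hη₀ hG₀ h₁, image_rhoR_coe, map_val_rosatiSymm]

include hη₀ hG₀ h₁ in
/-- **`dim_ℝ (End(X) ⊗ ℝ)^+ = ρ(X)`** (`(End(X) ⊗ ℝ)^+ ≅ 𝔞(End(X) ⊗ ℝ) = NS(X) ⊗ ℝ`, (3.5); then `finrank_neronSeveriR`).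
[cite: LooijengaLunts1997, §3 (3.5)] [cite: LooijengaLunts1997, §3 (3.6)] -/
theorem finrank_symmPart_endAlgReal : finrank ℝ (symmPart η₀ P₀ (endAlgReal Φ)) = finrank ℤ (neronSeveriGroup Φ) := by
  rw [← (formsOfEquivSymmPart h₁ (𝒜 := endAlgReal Φ)).finrank_eq, formsOf_endAlgReal_eq Φ hη₀ hG₀ h₁,
    finrank_neronSeveriR_eq_finrank_neronSeveriGroup]

include hη₀ hG₀ h₁ in
/-- **`dim_ℚ End⁰(X)^+ = ρ(X)`** — (3.5) "this defines an isomorphism of `NS(X)` onto the `†`-invariants in `End⁰(X)`" as a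
dimension count, for row A1-53's `rosatiSymm Φ G₀` (row A2-31 has the isomorphism itself, `nsEquivSymmEnd` / `finrank_symmEndRat_eq`).
[cite: LooijengaLunts1997, §3 (3.5)] -/
theorem finrank_rosatiSymm_eq_finrank_neronSeveriGroup :
    finrank ℚ (rosatiSymm Φ G₀) = finrank ℤ (neronSeveriGroup Φ) := by
  rw [← finrank_symmPart_endAlgReal Φ hη₀ hG₀ h₁, symmPart_endAlgReal_eq_span_rosatiSymm Φ hη₀ hG₀ h₁,
    finrank_span_rhoR_image_coe]

include hη₀ hG₀ h₁ in
/-- **`S = 𝔤_NS(X; ℚ)₀ ⊗ ℝ`: row A1-54's `S = span((End(X) ⊗ ℝ)^+ · (End(X) ⊗ ℝ)^+)` — the subspace with `𝔤₀ = ρψ₀(S^*)`,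
`degZeroHom : S ≅ 𝔤₀` — is the real span of `ρ(I)`, `I = rosatiSymmIdeal Φ G₀ = span(End⁰(X)^+ · End⁰(X)^+)` "the Lie ideal of
`End⁰(X)` that is generated by `End⁰(X)^+`" of row A1-53** (`rosatiSymmIdeal_eq_span_mul`).  With A1-54's `degZeroHom` this is the
printed clause "Its degree `0` summand can be identified with the Lie ideal of `End⁰(X)` that is generated by `End⁰(X)^+`" with the
`ℚ`-structure: `𝔤_NS(X; ℝ)₀ ≅ 𝔤_NS(X; ℚ)₀ ⊗ ℝ` where A1-53 reads `𝔤_NS(X; ℚ)₀ := I` in "`End⁰(X) = 𝔤_NS(X; ℚ)_0 × 𝔲(X)`".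
[cite: LooijengaLunts1997, §3 (3.6) and its proof ("𝔤_NS(X, ℝ)_0 must be the Lie ideal in End(X) ⊗ ℝ generated by (End(X) ⊗ ℝ)^+")] -/
theorem symmProdSpan_endAlgReal_eq_span_rosatiSymmIdeal : symmProdSpan η₀ P₀ (endAlgReal Φ) =
    Submodule.span ℝ ((fun A : endAlgRat Φ ↦ rhoR Φ A) '' (rosatiSymmIdeal Φ G₀ : Set (endAlgRat Φ))) := by
  rw [rosatiSymmIdeal_eq_span_mul hη₀ hG₀, span_image_rhoR_coe_span, symmProdSpan_eq_mul,
    symmPart_endAlgReal_eq_span_rosatiSymm Φ hη₀ hG₀ h₁, Submodule.span_mul_span]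
  refine congrArg _ (Set.ext fun c ↦ ⟨?_, ?_⟩)
  · rintro ⟨_, ⟨A, hA, rfl⟩, _, ⟨B, hB, rfl⟩, rfl⟩
    exact ⟨A * B, ⟨A, hA, B, hB, rfl⟩, by simp only [Subalgebra.coe_mul, map_mul]⟩
  · rintro ⟨_, ⟨A, hA, B, hB, rfl⟩, rfl⟩
    exact ⟨rhoR Φ A, ⟨A, hA, rfl⟩, rhoR Φ B, ⟨B, hB, rfl⟩, by simp only [Subalgebra.coe_mul, map_mul]⟩

include hη₀ hG₀ h₁ in
/-- **`dim_ℝ S = dim_ℚ 𝔤_NS(X; ℚ)₀`** (`= dim_ℚ I`, `I = rosatiSymmIdeal Φ G₀`). [cite: LooijengaLunts1997, §3 (3.6)] -/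
theorem finrank_symmProdSpan_endAlgReal :
    finrank ℝ (symmProdSpan η₀ P₀ (endAlgReal Φ)) = finrank ℚ (rosatiSymmIdeal Φ G₀) := by
  rw [symmProdSpan_endAlgReal_eq_span_rosatiSymmIdeal Φ hη₀ hG₀ h₁, finrank_span_rhoR_image_coe]

include hη₀ hG₀ h₁ in
/-- **`dim_ℝ 𝔤_NS(X; ℝ)₂ = ρ(X)`** ("Its degree `2` summand is canonically isomorphic to `NS(X) ⊗ ℚ`": row A1-54's
`neronSeveriDegTwoEquiv`, then `finrank_neronSeveriR_eq_finrank_neronSeveriGroup`). [cite: LooijengaLunts1997, §3 (3.6)] -/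
theorem finrank_neronSeveri_degTwo :
    finrank ℝ ((upPiece η₀ P₀ (endAlgReal Φ)).map (spinorRepLin E)) = finrank ℤ (neronSeveriGroup Φ) := by
  rw [← (neronSeveriDegTwoEquiv Φ hη₀ hG₀ h₁).finrank_eq, finrank_neronSeveriR_eq_finrank_neronSeveriGroup]

variable [Nontrivial E]

include hη₀ hG₀ h₁ in
/-- **`dim_ℝ 𝔤_NS(X; ℝ)₋₂ = ρ(X)`** (`𝔤₋₂ = ρψ₋₂((End(X) ⊗ ℝ)^+ η₀⁻¹) ≅ (End(X) ⊗ ℝ)^+ ≅ NS(X) ⊗ ℝ`). [cite: LooijengaLunts1997, §3 (3.6)] -/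
theorem finrank_neronSeveri_degMinusTwo :
    finrank ℝ ((lowPiece η₀ P₀ (endAlgReal Φ)).map (spinorRepLin E)) = finrank ℤ (neronSeveriGroup Φ) := by
  rw [finrank_map_lowPiece h₁, formsOf_endAlgReal_eq Φ hη₀ hG₀ h₁, finrank_neronSeveriR_eq_finrank_neronSeveriGroup]

include hη₀ hG₀ h₁ in
/-- **`dim_ℝ 𝔤_NS(X; ℝ)₀ = dim_ℚ 𝔤_NS(X; ℚ)₀`** (`𝔤₀ = ρψ₀(S^*) ≅ S = 𝔤_NS(X; ℚ)₀ ⊗ ℝ`). [cite: LooijengaLunts1997, §3 (3.6)] -/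
theorem finrank_neronSeveri_degZero :
    finrank ℝ ((midPiece η₀ P₀ (endAlgReal Φ)).map (spinorRepLin E)) = finrank ℚ (rosatiSymmIdeal Φ G₀) := by
  rw [finrank_map_midPiece h₁, finrank_symmProdSpan_endAlgReal Φ hη₀ hG₀ h₁]

include hη₀ hG₀ h₁ in
/-- **(3.6) as a dimension count: `dim_ℝ 𝔤_NS(X; ℝ) = 2ρ(X) + dim_ℚ 𝔤_NS(X; ℚ)₀`** for an abelian variety `X` with polarization
`η₀` (rational Gram matrix `G₀`, `P₀ = η₀♭⁻¹`): `𝔤_NS(X; ℝ) = 𝔤₋₂ ⊕ 𝔤₀ ⊕ 𝔤₂` with `dim 𝔤_{±2} = ρ(X)` and `dim 𝔤₀ = dim_ℚ I`,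
`I = rosatiSymmIdeal Φ G₀`. [cite: LooijengaLunts1997, §3 (3.6)] -/
theorem IsRiemannForm.finrank_neronSeveriLieAlgebra_aux :
    finrank ℝ (neronSeveriLieAlgebra Φ) = 2 * finrank ℤ (neronSeveriGroup Φ) + finrank ℚ (rosatiSymmIdeal Φ G₀) := by
  rw [neronSeveriLieAlgebra_eq_llModel Φ hη₀ hG₀ h₁, finrank_llModel h₁, finrank_symmPart_endAlgReal Φ hη₀ hG₀ h₁,
    finrank_symmProdSpan_endAlgReal Φ hη₀ hG₀ h₁]

include hη₀ hG₀ in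
/-- **(3.6) as a dimension count: `dim_ℝ 𝔤_NS(X; ℝ) = 2ρ(X) + dim_ℚ 𝔤_NS(X; ℚ)₀`**, for every polarization `η₀` of `X` and every
rational Gram matrix `G₀` of it (`𝔤_NS(X; ℚ)₀ = rosatiSymmIdeal Φ G₀` does not depend on the polarization, row A1-53's
`rosatiSymmIdeal_eq_rosatiSymmIdeal`). [cite: LooijengaLunts1997, §3 (3.6)] -/
theorem IsRiemannForm.finrank_neronSeveriLieAlgebra :
    finrank ℝ (neronSeveriLieAlgebra Φ) = 2 * finrank ℤ (neronSeveriGroup Φ) + finrank ℚ (rosatiSymmIdeal Φ G₀) := by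
  obtain ⟨P₀, h₁⟩ := hη₀.exists_rinv Φ
  exact hη₀.finrank_neronSeveriLieAlgebra_aux Φ hG₀ h₁

include hη₀ hG₀ in
/-- **`dim_ℝ 𝔤_NS(X; ℝ) + dim_ℚ 𝔲(X) = 2ρ(X) + dim_ℚ End⁰(X)`** — the dimension count of the whole of (3.6), its last clause
"`End⁰(X) = 𝔤_NS(X; ℚ)_0 × 𝔲(X)`" entering through row A1-53's `finrank_rosatiSymmIdeal_add_finrank_rosatiAntiInvariants`
(`𝔲(X) = rosatiAntiInvariants Φ`). [cite: LooijengaLunts1997, §3 (3.6)] -/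
theorem IsRiemannForm.finrank_neronSeveriLieAlgebra_add_finrank_rosatiAntiInvariants_aux :
    finrank ℝ (neronSeveriLieAlgebra Φ) + finrank ℚ (rosatiAntiInvariants Φ) =
      2 * finrank ℤ (neronSeveriGroup Φ) + finrank ℚ (endAlgRat Φ) := by
  rw [hη₀.finrank_neronSeveriLieAlgebra Φ hG₀, add_assoc, finrank_rosatiSymmIdeal_add_finrank_rosatiAntiInvariants hη₀ hG₀]

include hη₀ in
/-- **`dim_ℝ 𝔤_NS(X; ℝ) + dim_ℚ 𝔲(X) = 2ρ(X) + dim_ℚ End⁰(X)`** for every polarized abelian variety `(X, η₀)` (the rational Gram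
matrix is produced inside, `IsRiemannForm.exists_ratMatrix_latticeGram_isUnit`). [cite: LooijengaLunts1997, §3 (3.6)] -/
theorem IsRiemannForm.finrank_neronSeveriLieAlgebra_add_finrank_rosatiAntiInvariants :
    finrank ℝ (neronSeveriLieAlgebra Φ) + finrank ℚ (rosatiAntiInvariants Φ) =
      2 * finrank ℤ (neronSeveriGroup Φ) + finrank ℚ (endAlgRat Φ) := by
  obtain ⟨G₀, hG₀, -⟩ := hη₀.exists_ratMatrix_latticeGram_isUnit
  exact hη₀.finrank_neronSeveriLieAlgebra_add_finrank_rosatiAntiInvariants_aux Φ hG₀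

omit [DecidableEq ι] in
/-- **`dim_ℝ 𝔤_NS(X; ℝ) + dim_ℚ 𝔲(X) = 2ρ(X) + dim_ℚ End⁰(X)` for an abelian variety `X`.** [cite: LooijengaLunts1997, §3 (3.6)] -/
theorem IsAbelianVariety.finrank_neronSeveriLieAlgebra_add_finrank_rosatiAntiInvariants [DecidableEq ι]
    (hX : IsAbelianVariety Φ) :
    finrank ℝ (neronSeveriLieAlgebra Φ) + finrank ℚ (rosatiAntiInvariants Φ) =
      2 * finrank ℤ (neronSeveriGroup Φ) + finrank ℚ (endAlgRat Φ) := by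
  obtain ⟨η₀, hη₀⟩ := hX
  exact hη₀.finrank_neronSeveriLieAlgebra_add_finrank_rosatiAntiInvariants Φ

include hη₀ hG₀ in
/-- **`3ρ(X) ≤ dim_ℝ 𝔤_NS(X; ℝ)`** (`End⁰(X)^+ ⊆ 𝔤_NS(X; ℚ)₀` and `dim_ℚ End⁰(X)^+ = ρ(X)`; equality iff `𝔤_NS(X; ℚ)₀ = End⁰(X)^+`,
e.g. for commutative `End⁰(X)`, `finrank_neronSeveriLieAlgebra_of_forall_mul_comm`). [cite: LooijengaLunts1997, §3 (3.5)] [cite: LooijengaLunts1997, §3 (3.6)] -/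
theorem IsRiemannForm.three_mul_finrank_neronSeveriGroup_le :
    3 * finrank ℤ (neronSeveriGroup Φ) ≤ finrank ℝ (neronSeveriLieAlgebra Φ) := by
  obtain ⟨P₀, h₁⟩ := hη₀.exists_rinv Φ
  rw [hη₀.finrank_neronSeveriLieAlgebra Φ hG₀, ← finrank_rosatiSymm_eq_finrank_neronSeveriGroup Φ hη₀ hG₀ h₁]
  have h := Submodule.finrank_mono (rosatiSymm_le_rosatiSymmIdeal (Φ := Φ) (G := G₀))
  omega

include hη₀ in
/-- **`dim_ℝ 𝔤_NS(X; ℝ) ≤ 2ρ(X) + dim_ℚ End⁰(X)`**, with equality iff `𝔲(X) = 0`. [cite: LooijengaLunts1997, §3 (3.6)] -/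
theorem IsRiemannForm.finrank_neronSeveriLieAlgebra_le :
    finrank ℝ (neronSeveriLieAlgebra Φ) ≤ 2 * finrank ℤ (neronSeveriGroup Φ) + finrank ℚ (endAlgRat Φ) := by
  have h := hη₀.finrank_neronSeveriLieAlgebra_add_finrank_rosatiAntiInvariants Φ
  omega

include hη₀ hG₀ in
/-- **Commutative `End⁰(X)` (e.g. `End⁰(X) = ℚ`, a totally real or a CM field): `dim_ℝ 𝔤_NS(X; ℝ) = 3ρ(X)`** — then
`𝔤_NS(X; ℚ)₀ = End⁰(X)^+` (row A1-53's `rosatiSymmIdeal_eq_rosatiSymm_of_forall_mul_comm`) has dimension `ρ(X)`.  (For `End⁰(X) = ℚ`: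
`ρ = 1`, `dim 𝔤_NS(X; ℝ) = 3`, the `𝔰𝔩₂` of the polarization; LL (3.8), totally real case `m = 1`: "`𝔤_NS(A; ℚ)` is a `K₀`-form of
`𝔰𝔭(2)`", of `ℚ`-dimension `3e₀ = 3ρ(A)`.) [cite: LooijengaLunts1997, §3 (3.6), (3.8) (totally real multiplication, m = 1)] -/
theorem IsRiemannForm.finrank_neronSeveriLieAlgebra_of_forall_mul_comm (hc : ∀ A B : endAlgRat Φ, A * B = B * A) :
    finrank ℝ (neronSeveriLieAlgebra Φ) = 3 * finrank ℤ (neronSeveriGroup Φ) := by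
  obtain ⟨P₀, h₁⟩ := hη₀.exists_rinv Φ
  rw [hη₀.finrank_neronSeveriLieAlgebra Φ hG₀, rosatiSymmIdeal_eq_rosatiSymm_of_forall_mul_comm hc,
    finrank_rosatiSymm_eq_finrank_neronSeveriGroup Φ hη₀ hG₀ h₁]
  ring

end TorusDimension

/-! ### §5 Junction with row A1-50: `σ_λ` and the `†`-invariants -/

section JunctionA150

variable {E : Type*} [NormedAddCommGroup E] [NormedSpace ℂ E] [FiniteDimensional ℂ E]
  {κ : E [⋀^Fin 2]→L[ℝ] ℝ} (hnd : ∀ v : E, v ≠ 0 → ∃ w : E, κ ![v, w] ≠ 0)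

/-- **Junction with row A1-50: `σ_λ` agrees** — A1-54's `sigmaMap P₀ λ = P₀ ∘ λ♭` for `P₀ = sharp hnd = κ♭⁻¹` (A1-50) is A1-50's
`sigma hnd λ = κ♭⁻¹ ∘ λ♭` (definitionally). [cite: LooijengaLunts1997, §3 (3.5) ("there is a unique σ ∈ End(V) such that λ(a, b) = κ(σ_λ a, b)")] -/
theorem sigmaMap_sharp_apply (lam : E [⋀^Fin 2]→L[ℝ] ℝ) : sigmaMap (sharp hnd) lam = sigma hnd lam := rfl

/-- `sigmaMap (sharp hnd) = sigma hnd` as functions. [cite: LooijengaLunts1997, §3 (3.5)] -/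
theorem coe_sigmaMap_sharp : ⇑(sigmaMap (sharp hnd)) = sigma hnd := rfl

/-- **A1-54's `†`-fixed elements for `P₀ = κ♭⁻¹` are A1-50's `†`-invariants**: `τ† = τ ↔ κ(τ a, b) = κ(a, τ b)` for all `a, b`.
[cite: LooijengaLunts1997, §3 before (3.5) ("κ(σv, w) = κ(v, σ†w)")] -/
theorem rosatiAdj_sharp_eq_self_iff {τ : E →ₗ[ℝ] E} : rosatiAdj κ (sharp hnd) τ = τ ↔ τ ∈ rosatiInvariants κ := by
  rw [rosatiAdj_eq_self_iff (flat_comp_sharp hnd), mem_rosatiInvariants_iff]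

/-- A1-54's `𝒜^+ = symmPart κ κ♭⁻¹ 𝒜` is `𝒜 ∩` A1-50's `rosatiInvariants κ`. [cite: LooijengaLunts1997, §3 (3.5)] -/
theorem symmPart_sharp_eq (𝒜 : Subalgebra ℝ (E →ₗ[ℝ] E)) :
    symmPart κ (sharp hnd) 𝒜 = Subalgebra.toSubmodule 𝒜 ⊓ rosatiInvariants κ := by
  ext τ
  rw [mem_symmPart_iff, rosatiAdj_sharp_eq_self_iff, Submodule.mem_inf, Subalgebra.mem_toSubmodule]

/-- For `𝒜 = End(V)`: `End(V)^+ = rosatiInvariants κ` (A1-50's "`†`-invariants of `End(V)`"). [cite: LooijengaLunts1997, §3 (3.5)] -/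
theorem symmPart_sharp_top : symmPart κ (sharp hnd) ⊤ = rosatiInvariants κ := by
  rw [symmPart_sharp_eq, Algebra.top_toSubmodule, top_inf_eq]

/-- A1-54's `𝔞(𝒜) = formsOf κ♭⁻¹ 𝒜` for `P₀ = sharp hnd`: the `2`-forms `λ` with A1-50's `σ_λ = sigma hnd λ ∈ 𝒜`. [cite: LooijengaLunts1997, §3 (3.5)] -/
theorem mem_formsOf_sharp_iff (𝒜 : Subalgebra ℝ (E →ₗ[ℝ] E)) {lam : E [⋀^Fin 2]→L[ℝ] ℝ} :
    lam ∈ formsOf (sharp hnd) 𝒜 ↔ sigma hnd lam ∈ 𝒜 := Iff.rfl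

/-- `𝔞(End(V)) = ⋀²V^*`: every `2`-form has its `σ_λ` in `End(V)` ((3.5) for all of `End(V)` is A1-50's
`twoFormEquivRosatiInvariants : ⋀²V^* ≅ rosatiInvariants κ`). [cite: LooijengaLunts1997, §3 (3.5)] -/
theorem formsOf_sharp_top : formsOf (sharp hnd) (⊤ : Subalgebra ℝ (E →ₗ[ℝ] E)) = ⊤ :=
  eq_top_iff.2 fun _ _ ↦ (mem_formsOf_sharp_iff hnd ⊤).2 Algebra.mem_top

/-- **The two formalised (3.5)-isomorphisms agree**: A1-54's `formsOfEquivSymmPart` (on `𝒜 = End(V)`, `P₀ = κ♭⁻¹`) and A1-50's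
`twoFormEquivRosatiInvariants` have the same underlying map `λ ↦ σ_λ`. [cite: LooijengaLunts1997, §3 (3.5)] -/
theorem coe_formsOfEquivSymmPart_sharp (lam : formsOf (sharp hnd) (⊤ : Subalgebra ℝ (E →ₗ[ℝ] E))) :
    ((formsOfEquivSymmPart (flat_comp_sharp hnd) (𝒜 := ⊤) lam : symmPart κ (sharp hnd) ⊤) : E →ₗ[ℝ] E) =
      ((twoFormEquivRosatiInvariants hnd (lam : E [⋀^Fin 2]→L[ℝ] ℝ) : rosatiInvariants κ) : E →ₗ[ℝ] E) := by
  rw [coe_formsOfEquivSymmPart_apply, coe_twoFormEquivRosatiInvariants_apply]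
  rfl

end JunctionA150

end ComplexTorus

end Literature.Geometry.Kaehler
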